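import Summits.HodgeConjecture.CorCM.OcticCMFieldAutomorphismsFibres
import Literature.AlgebraicGeometry.Pohlmann1968.WeilTypeCMSubfieldExceptionalClasses
import HarnessLib

/-!
# Model CM types on `ℤ/2 × ℤ/N` ⟹ primitive CM types of Weil type over an imaginary quadratic subfield
# (a transfer theorem for abelian CM fields cyclic over an imaginary quadratic field)

COR-CM (cell `pub-hodgecm2`), binder seat b04 (gen 15), count-neutral claim ABELIAN-2POWER-CLASSIF, part IIIa; the
construction of gen 14's `GaloisDodecic.exists_isPrimitive_not_isNondegenerate_of_comm` (`N = 6`) made GENERIC in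
the modulus.  KERNEL ONLY: theorems; no definition, no named fact, no `sorry`.

**`exists_isPrimitive_weilType_of_model`.**  Let `K` be a CM field, Galois over `ℚ` with COMMUTATIVE Galois group,
`k ⊆ K` a quadratic subfield with a complex place (imaginary quadratic) such that `Gal(K/k)` is CYCLIC of order
`N = [K:k]`, generated by `g`; then `Gal(K/ℚ) = {c^b g^m}` (`c` = complex conjugation, `c ∉ Gal(K/k)`), i.e.
`ψ(b, m) = c^b g^m` is a bijection `ℤ/2 × ℤ/N → Gal(K/ℚ)`.  Given a MODEL SET `T₀ ⊆ ℤ/2 × ℤ/N` which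
(i) is a CM set for `(1, 0)` (`x ∈ T₀ ↔ (1,0) + x ∉ T₀`), (ii) has trivial stabiliser under translations, and
(iii) is BALANCED over the first coordinate (`#{x ∈ T₀ : x.1 = b} = #{x ∉ T₀ : x.1 = b}` for `b = 0, 1`), the set
`Φ = {σ_{ψ(x)} : x ∈ T₀}` (`σ_h = φ₀ ∘ h⁻¹`, Shimura §8.1) is a CM type of `K` which is PRIMITIVE (the translates under
`Aut(ℂ)` act through `x ↦ x − d`) and of WEIL TYPE over `k` (every embedding of `k` has as many extensions inside
`Φ` as outside) — hence DEGENERATE by Yanai's `a = b` criterion (`Pohlmann1968.not_isNondegenerate_of_fibres_balanced`):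
**`exists_isPrimitive_not_isNondegenerate_of_model`**.

Used with kernel-decided models for `N = 8, 16` in part IIIb (`CorCM/AbelianTwoPowerCyclicOverImaginaryQuadratic`:
abelian CM fields of degree `16`/`32` cyclic over an IMAGINARY quadratic field carry primitive degenerate types —
the sharpness half of part Ib's "cyclic over a REAL quadratic field ⟹ all primitive types nondegenerate").

## References

* [Shimura1998] G. Shimura, *Abelian Varieties with Complex Multiplication and Modular Functions*, §8.1, §8.2
  Prop. 26, §18.2 Lemma.
* [Gordon1999HodgeAVSurvey] B. B. Gordon, *A survey of the Hodge conjecture for abelian varieties*, §9.4.2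
  (Lenstra's types on `ℚ(ζ₃₂)`), §9.4.3 (Theorem [B.140] = Yanai 1994).
* [Dodson1984] B. Dodson, *The structure of Galois groups of CM-fields*, Trans. AMS 283 (1984), §3.1.1.
-/

noncomputable section

open CategoryTheory CategoryTheory.Limits NumberField

namespace Summit.HodgeConjecture.CorCM.ModelType

open Literature.NumberTheory.ComplexMultiplication
open Literature.AlgebraicGeometry.Motives (CMType)
open Literature.AlgebraicGeometry.Pohlmann1968
open Summit.HodgeConjecture.CorCM.GaloisOctic

open scoped Classical

variable {K : Type} [Field K] [NumberField K] [IsCMField K]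

/-- **Model set ⟹ primitive CM type of Weil type over `k`.**  See the module docstring: `K` Galois CM with commutative
Galois group, `k` an imaginary quadratic subfield with `Gal(K/k)` cyclic of order `N`, and `T₀ ⊆ ℤ/2 × ℤ/N` a CM
set for `(1,0)` with trivial stabiliser, balanced over the first coordinate; then `K` has a PRIMITIVE CM type
balanced over `k` (as many extensions of each embedding of `k` inside as outside). [cite: Shimura1998, §8.2 Prop. 26]
[cite: Gordon1999HodgeAVSurvey, §9.4.3 (Theorem [B.140])] -/
theorem exists_isPrimitive_weilType_of_model [IsGalois ℚ K] {N : ℕ} [NeZero N]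
    (hcomm : ∀ x y : K ≃ₐ[ℚ] K, x * y = y * x) (k : IntermediateField ℚ K) (hk2 : Module.finrank ℚ k = 2)
    (hKk : Module.finrank k K = N) (τ₀ : k →+* ℂ) (hτ₀ : ComplexEmbedding.conjugate τ₀ ≠ τ₀)
    (hcyc : IsCyclic k.fixingSubgroup) (T₀ : Finset (ZMod 2 × ZMod N))
    (hT₀cm : ∀ x : ZMod 2 × ZMod N, x ∈ T₀ ↔ (1, 0) + x ∉ T₀)
    (hT₀prim : ∀ v : ZMod 2 × ZMod N, v ≠ 0 → ∃ w : ZMod 2 × ZMod N, ¬ (w ∈ T₀ ↔ v + w ∈ T₀))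
    (hT₀bal : ∀ b : ZMod 2,
      (Finset.univ.filter fun x : ZMod 2 × ZMod N => x.1 = b ∧ x ∈ T₀).card =
        (Finset.univ.filter fun x : ZMod 2 × ZMod N => x.1 = b ∧ x ∉ T₀).card)
    (φ₀ : K →+* ℂ) :
    ∃ Φ : CMType K, IsPrimitive (ℂ ≃+* ℂ) Φ.1 φ₀ ∧
      ∀ τ : k →+* ℂ, {φ : K →+* ℂ | φ.comp (algebraMap k K) = τ ∧ φ ∈ Φ.1}.ncard =
        {φ : K →+* ℂ | φ.comp (algebraMap k K) = τ ∧ φ ∉ Φ.1}.ncard := by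
  haveI := isPretransitive_ringEquiv_complex (K := K)
  set G := K ≃ₐ[ℚ] K
  set c : G := (IsCMField.complexConj K).restrictScalars ℚ with hc_def
  set H : Subgroup G := k.fixingSubgroup with hH_def
  -- `|G| = 2N`, `|H| = N`, `c ∉ H`, `c` of order `2`
  have hN0 : 0 < N := Nat.pos_of_ne_zero (NeZero.ne N)
  have hK : Module.finrank ℚ K = 2 * N := by rw [← Module.finrank_mul_finrank ℚ k K, hk2, hKk]
  have hG : Nat.card G = 2 * N := by rw [IsGalois.card_aut_eq_finrank, hK]
  have hH : Nat.card H = N := by rw [hH_def, IsGalois.card_fixingSubgroup_eq_finrank k, hKk]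
  have hcH : c ∉ H := complexConj_not_mem_fixingSubgroup k τ₀ hτ₀
  have hc1 : c ≠ 1 := fun h => hcH (h ▸ H.one_mem)
  have hcc : c * c = 1 := complexConj_mul_self
  have hoc : orderOf c = 2 := orderOf_eq_prime (by rw [pow_two, hcc]) hc1
  have hv1 : (1 : ZMod 2).val = 1 := rfl
  have h2' : ∀ a : ZMod 2, a ≠ 0 → a = 1 := by decide
  -- a generator `g` of `H`, of order `N`
  obtain ⟨g₀, hg₀⟩ := hcyc.exists_generator
  set g : G := (g₀ : G) with hg_def
  have hgH : g ∈ H := g₀.2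
  have hog : orderOf g = N := by rw [hg_def, Subgroup.orderOf_coe, orderOf_eq_card_of_forall_mem_zpowers hg₀, hH]
  -- the parametrisation `ψ (b, m) = c^b g^m`
  set ψ : ZMod 2 × ZMod N → G := fun x => c ^ x.1.val * g ^ x.2.val with hψ_def
  have hc2 : ∀ n : ℕ, c ^ (n % 2) = c ^ n := fun n => by rw [← hoc]; exact pow_mod_orderOf c n
  have hgN : ∀ n : ℕ, g ^ (n % N) = g ^ n := fun n => by rw [← hog]; exact pow_mod_orderOf g n
  have hψmul : ∀ x y, ψ (x + y) = ψ x * ψ y := by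
    intro x y
    simp only [hψ_def, Prod.fst_add, Prod.snd_add, ZMod.val_add]
    rw [hc2, hgN, pow_add, pow_add, mul_assoc, mul_assoc, ← mul_assoc (c ^ y.1.val),
      hcomm (c ^ y.1.val) (g ^ x.2.val)]
    simp only [mul_assoc]
  have hψH : ∀ x, ψ x ∈ H ↔ x.1 = 0 := by
    intro x
    constructor
    · intro hx
      by_contra h1
      have hx1 : x.1 = 1 := h2' x.1 h1
      apply hcH
      have : ψ x = c * g ^ x.2.val := by
        show c ^ x.1.val * g ^ x.2.val = _
        rw [hx1, hv1, pow_one]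
      rw [this] at hx
      exact (Subgroup.mul_mem_cancel_right H (H.pow_mem hgH _)).1 hx
    · intro h0
      simp only [hψ_def, h0, ZMod.val_zero, pow_zero, one_mul]
      exact H.pow_mem hgH _
  have hψinj : Function.Injective ψ := by
    have hz : ∀ z, ψ z = 1 → z = 0 := by
      intro z hz
      have hz1 : z.1 = 0 := (hψH z).1 (hz ▸ H.one_mem)
      have hz2 : z.2 = 0 := by
        have hpow : g ^ z.2.val = 1 := by
          have : ψ z = g ^ z.2.val := by simp only [hψ_def, hz1, ZMod.val_zero, pow_zero, one_mul]
          rw [← this, hz]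
        by_contra hne
        have hpos : 0 < z.2.val := Nat.pos_of_ne_zero fun h0 => hne ((ZMod.val_eq_zero z.2).1 h0)
        have hle := orderOf_le_of_pow_eq_one hpos hpow
        have hlt := z.2.val_lt
        rw [hog] at hle
        omega
      exact Prod.ext hz1 hz2
    intro x y hxy
    have h := hψmul (x - y) y
    rw [sub_add_cancel, hxy] at h
    have h1 : (1 : G) * ψ y = ψ (x - y) * ψ y := by rw [one_mul]; exact h
    have := hz _ (mul_right_cancel h1).symm
    rwa [sub_eq_zero] at this
  have hψbij : Function.Bijective ψ :=
    hψinj.bijective_of_nat_card_le (by rw [hG, Nat.card_prod, Nat.card_zmod, Nat.card_zmod])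
  have hψc : ψ (1, 0) = c := by
    show c ^ (1 : ZMod 2).val * g ^ (0 : ZMod N).val = c
    rw [ZMod.val_zero, pow_zero, mul_one, hv1, pow_one]
  -- the embeddings `E x = σ_{ψ x}`; every embedding is some `E x`
  set E : ZMod 2 × ZMod N → (K →+* ℂ) := fun x => embOf φ₀ (ψ x) with hE_def
  have hEinj : Function.Injective E := fun x y hxy => hψinj ((embOf_bijective φ₀).1 hxy)
  have hEsurj : ∀ φ : K →+* ℂ, ∃ x, E x = φ := fun φ => by
    obtain ⟨h, rfl⟩ := (embOf_bijective φ₀).2 φ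
    obtain ⟨x, rfl⟩ := hψbij.2 h
    exact ⟨x, rfl⟩
  have hEconj : ∀ x, ComplexEmbedding.conjugate (E x) = E ((1, 0) + x) := fun x => by
    show ComplexEmbedding.conjugate (embOf φ₀ (ψ x)) = embOf φ₀ (ψ ((1, 0) + x))
    rw [hψmul, hψc, embOf_complexConj_mul]
  have hEsmul : ∀ (x d : ZMod 2 × ZMod N) {τ : ℂ ≃+* ℂ}, (∀ a, τ (φ₀ a) = φ₀ (ψ d a)) →
      τ • E x = E (x - d) := by
    intro x d τ hτ
    show τ • embOf φ₀ (ψ x) = embOf φ₀ (ψ (x - d))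
    rw [smul_embOf_of_comp φ₀ hτ]
    congr 1
    rw [mul_inv_eq_iff_eq_mul, ← hψmul, sub_add_cancel]
  -- the CM type `Φ = E(T₀)`
  set S : Set (K →+* ℂ) := E '' (T₀ : Set (ZMod 2 × ZMod N)) with hS_def
  have hmemE : ∀ x, E x ∈ S ↔ x ∈ T₀ := fun x => by
    rw [hS_def, hEinj.mem_set_image, Finset.mem_coe]
  have hcm : ∀ φ, φ ∈ S ↔ ComplexEmbedding.conjugate φ ∉ S := by
    intro φ
    obtain ⟨x, rfl⟩ := hEsurj φ
    rw [hEconj, hmemE, hmemE]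
    exact hT₀cm x
  let Φ : CMType K := ⟨S, hcm⟩
  -- primitive: the translates act through `x ↦ x - d`, and `T₀` has trivial stabiliser
  have hprim : IsPrimitive (ℂ ≃+* ℂ) Φ.1 φ₀ := by
    rw [isPrimitive_iff_forall_eq]
    intro φ₁ φ₂ hsep
    obtain ⟨x₁, rfl⟩ := hEsurj φ₁
    obtain ⟨x₂, rfl⟩ := hEsurj φ₂
    by_contra hne
    have hv : x₂ - x₁ ≠ 0 := fun h => hne (by rw [sub_eq_zero] at h; rw [h])
    obtain ⟨w, hw⟩ := hT₀prim (x₂ - x₁) hv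
    obtain ⟨τ, hτ⟩ := exists_ringEquiv_comp_eq_algEquiv φ₀ (ψ (x₁ - w))
    have h := hsep τ
    rw [hEsmul x₁ (x₁ - w) hτ, hEsmul x₂ (x₁ - w) hτ, sub_sub_cancel,
      show x₂ - (x₁ - w) = x₂ - x₁ + w by abel] at h
    exact hw ((hmemE w).symm.trans (h.trans (hmemE _)))
  refine ⟨Φ, hprim, fun τ => ?_⟩
  -- restriction of `E x` to `k`
  have hres0 : ∀ x, (E x).comp (algebraMap k K) = φ₀.comp (algebraMap k K) ↔ x.1 = 0 := fun x => by
    show (embOf φ₀ (ψ x)).comp (algebraMap k K) = _ ↔ _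
    rw [embOf_comp_algebraMap_eq_iff, hψH]
  have hconj_comp : ∀ φ : K →+* ℂ, (ComplexEmbedding.conjugate φ).comp (algebraMap k K) =
      ComplexEmbedding.conjugate (φ.comp (algebraMap k K)) := fun φ => rfl
  have hcc' : ∀ ρ : k →+* ℂ, ComplexEmbedding.conjugate (ComplexEmbedding.conjugate ρ) = ρ :=
    fun ρ => star_star ρ
  have h2 : ∀ a : ZMod 2, a = 0 ∨ a = 1 := by decide
  have hres1 : ∀ x, (E x).comp (algebraMap k K) = ComplexEmbedding.conjugate (φ₀.comp (algebraMap k K)) ↔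
      x.1 = 1 := fun x => by
    constructor
    · intro h
      have h' : (E ((1, 0) + x)).comp (algebraMap k K) = φ₀.comp (algebraMap k K) := by
        rw [← hEconj, hconj_comp, h, hcc']
      have h0 := (hres0 _).1 h'
      simp only [Prod.fst_add] at h0
      rcases h2 x.1 with hx | hx
      · rw [hx] at h0; exact absurd h0 (by decide)
      · exact hx
    · intro hx
      have h' : (E ((1, 0) + x)).comp (algebraMap k K) = φ₀.comp (algebraMap k K) := by
        rw [hres0]
        simp only [Prod.fst_add, hx]
        decide
      rw [← hEconj, hconj_comp] at h'
      rw [← hcc' ((E x).comp (algebraMap k K)), h']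
  -- fibres over `k` as images of model sets
  have hfib : ∀ (ρ : k →+* ℂ) (P : (K →+* ℂ) → Prop),
      {φ : K →+* ℂ | φ.comp (algebraMap k K) = ρ ∧ P φ} =
        E '' {x | (E x).comp (algebraMap k K) = ρ ∧ P (E x)} := by
    intro ρ P
    ext φ
    constructor
    · rintro ⟨hφ, hP⟩
      obtain ⟨x, rfl⟩ := hEsurj φ
      exact ⟨x, ⟨hφ, hP⟩, rfl⟩
    · rintro ⟨x, ⟨hx, hP⟩, rfl⟩
      exact ⟨hx, hP⟩
  have hcount : ∀ b : ZMod 2,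
      {x : ZMod 2 × ZMod N | x.1 = b ∧ E x ∈ S}.ncard = {x : ZMod 2 × ZMod N | x.1 = b ∧ E x ∉ S}.ncard := by
    intro b
    have h := hT₀bal b
    have hin : {x : ZMod 2 × ZMod N | x.1 = b ∧ E x ∈ S}.ncard =
        (Finset.univ.filter fun x : ZMod 2 × ZMod N => x.1 = b ∧ x ∈ T₀).card := by
      rw [← Set.ncard_coe_finset]
      congr 1
      ext x
      simp only [Set.mem_setOf_eq, Finset.coe_filter, Finset.mem_univ, true_and, hmemE]
    have hout : {x : ZMod 2 × ZMod N | x.1 = b ∧ E x ∉ S}.ncard =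
        (Finset.univ.filter fun x : ZMod 2 × ZMod N => x.1 = b ∧ x ∉ T₀).card := by
      rw [← Set.ncard_coe_finset]
      congr 1
      ext x
      simp only [Set.mem_setOf_eq, Finset.coe_filter, Finset.mem_univ, true_and, hmemE]
    rw [hin, hout, h]
  -- `φ₀|_k` is not real, and `τ` is `φ₀|_k` or its conjugate
  have hφ₀k : ComplexEmbedding.conjugate (φ₀.comp (algebraMap k K)) ≠ φ₀.comp (algebraMap k K) :=
    conjugate_ne_of_finrank_eq_two k hk2 τ₀ hτ₀ φ₀
  obtain ⟨g', hg'⟩ := exists_embOf_comp_algebraMap_eq φ₀ k τ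
  rcases comp_algebraMap_eq_or k hk2 (φ₀.comp (algebraMap k K)) hφ₀k (embOf φ₀ g') with hτ | hτ
  · -- `τ = φ₀|_k`: the fibre is `E({0} × ℤ/N)`
    rw [← hg', hτ, hfib _ (fun φ => φ ∈ Φ.1), hfib _ (fun φ => φ ∉ Φ.1), Set.ncard_image_of_injective _ hEinj,
      Set.ncard_image_of_injective _ hEinj]
    simp only [hres0]
    exact hcount 0
  · -- `τ = conj(φ₀|_k)`: the fibre is `E({1} × ℤ/N)`
    rw [← hg', hτ, hfib _ (fun φ => φ ∈ Φ.1), hfib _ (fun φ => φ ∉ Φ.1), Set.ncard_image_of_injective _ hEinj,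
      Set.ncard_image_of_injective _ hEinj]
    simp only [hres1]
    exact hcount 1

/-- **Model set ⟹ a PRIMITIVE DEGENERATE CM type** (Weil type over `k` ⟹ degenerate, Yanai's `a = b`:
`Pohlmann1968.not_isNondegenerate_of_fibres_balanced`). [cite: Gordon1999HodgeAVSurvey, §9.4.3 (Theorem [B.140])]
[cite: Shimura1998, §8.2 Prop. 26] -/
theorem exists_isPrimitive_not_isNondegenerate_of_model [IsGalois ℚ K] {N : ℕ} [NeZero N]
    (hcomm : ∀ x y : K ≃ₐ[ℚ] K, x * y = y * x) (k : IntermediateField ℚ K) (hk2 : Module.finrank ℚ k = 2)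
    (hKk : Module.finrank k K = N) (τ₀ : k →+* ℂ) (hτ₀ : ComplexEmbedding.conjugate τ₀ ≠ τ₀)
    (hcyc : IsCyclic k.fixingSubgroup) (T₀ : Finset (ZMod 2 × ZMod N))
    (hT₀cm : ∀ x : ZMod 2 × ZMod N, x ∈ T₀ ↔ (1, 0) + x ∉ T₀)
    (hT₀prim : ∀ v : ZMod 2 × ZMod N, v ≠ 0 → ∃ w : ZMod 2 × ZMod N, ¬ (w ∈ T₀ ↔ v + w ∈ T₀))
    (hT₀bal : ∀ b : ZMod 2,
      (Finset.univ.filter fun x : ZMod 2 × ZMod N => x.1 = b ∧ x ∈ T₀).card =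
        (Finset.univ.filter fun x : ZMod 2 × ZMod N => x.1 = b ∧ x ∉ T₀).card)
    (φ₀ : K →+* ℂ) :
    ∃ Φ : CMType K, IsPrimitive (ℂ ≃+* ℂ) Φ.1 φ₀ ∧ ¬ IsNondegenerate Φ := by
  obtain ⟨Φ, hprim, hW⟩ := exists_isPrimitive_weilType_of_model hcomm k hk2 hKk τ₀ hτ₀ hcyc T₀ hT₀cm hT₀prim
    hT₀bal φ₀
  exact ⟨Φ, hprim, not_isNondegenerate_of_fibres_balanced (algebraMap k K) hW hτ₀⟩

end Summit.HodgeConjecture.CorCM.ModelType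

end
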